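/-
Copyright (c) 2026 the pub-hodgecm-mathlib formalisation cell (harness21).  Prover seat hodgecm-mathlib-K2Liu-p05 (g0): Track B «K2-LIT»,
#184♮ = hLiu418 = stmt-HodgeConjecture-24832; socket #32d `sig_K2LiuDoublingHeightDecayLocal` of `Cruxes/HLiu418/Lines/K2_Liu_CurveThetaSigs_U5d_ZetaS.lean`
(ED. 1 a836627a4002dcd3 :224) — organ (V) of the split finite slice: Cartan double-coset counts and volumes; K2/STATUS 2026-09-04 (K2Liu-p05 (g0)).
-/
import Summits.HodgeConjecture.HodgeConjecture.Theorems.K2LiuDoublingHeightSliceCartanBound   -- ★ (A2) `integrable_of_cartanSeries_of_isOpen`, `IsCartanFamily`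
import Summits.HodgeConjecture.HodgeConjecture.Theorems.K2LiuCartanLatticeSummable           -- ★ (LT) `summable_cartanLattice`
import Literature.NumberTheory.Automorphic.HeckeCosetCountGL                                  -- ★ `ncard_cosets_glIntDet_le_pow_mul`
import Literature.NumberTheory.Automorphic.CartanDecompositionGLnUnique                       -- ★ Cartan decomposition of `GL_n`, uniqueness
import HarnessLib

/-!
# Crux `HLiu418`, road `K2_Liu`, unit U5d, socket #32d — organ (V): COUNTS AND VOLUMES OF CARTAN DOUBLE COSETS (split place)

Cell `hodgecm-mathlib`, crux item hLiu418 = `stmt-HodgeConjecture-24832`; squad K2 ∕ K2Liu, LEAD F0P6-plan (g10), planner K2Liu-plan (g2), prover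
K2Liu-p05 (g0).  THEOREMS ONLY (no `def` ∕ instance ∕ notation ∕ named-fact hypothesis ∕ `sorry`, default heartbeats); lane
`--supports stmt-HodgeConjecture-24832 --as helper` (count-neutral).

After ★ (R) `doublingHeightDecayLocal_of_slices`, ★ (A1) `exists_placeSlice_quasiBiInvariant`, ★ (A2) `integrable_of_cartanSeries_of_isOpen` and
★ (LT) `summable_cartanLattice`, the finite slice of #32d at a place `v ∈ S` SPLIT in `L ∕ L⁺` is integrable as soon as the CARTAN SERIES
`∑_a ν(K₀ t_a K₀) ψ(t_a)` converges, where — through any group isomorphism `e : G_v ≃* GL_N(F)` (★ `UnitaryGroup.localPiSplitEquiv`, `F = L_w`) —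
`K₀ = e⁻¹ GL_N(𝒪)` and `t_a = e⁻¹ ϖ^a` (`a ∈ ℤ^N` antitone).  This file supplies the GROUP-THEORETIC half of that series
([Macdonald1995, Ch. V §2 (2.6), (2.9)]; [CartierCorvallis1979, §IV.2]; [Bump1997, Prop. 4.6.2]):
* §1 (any group) `finite_and_ncard_image_mk_le_of_hom` — a hom `φ : G →* G′` with `φ⁻¹ K′ = K` injects `G ∕ K ↪ G′ ∕ K′` compatibly with
  `D ↦ φ(D)`, so `#(D ∕ K) ≤ #(φ D ∕ K′)`; `ncard_image_mk_mul_le` — `#(A·B ∕ K) ≤ #(A ∕ K) · #(B ∕ K)` for `B` left-`K`-stable;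
  `measure_le_ncard_mul` — `ν(D) ≤ #(D ∕ K) · ν(K)` for a left-invariant `ν`; `isCartanFamily_of_mulEquiv` — transport of ★ `IsCartanFamily`.
* §2 (`GL_N(F)`, `F` non-archimedean local, `K = GL_N(𝒪)`, `q = #𝓀`) `isCartanFamily_glInt_zpowDiagGL` — `GL_N(F) = ⨆_{a antitone} K ϖ^a K`
  (★ `exists_glInt_mul_mul_eq_zpowDiagGL`, ★ `CartanUnique.eq_of_glInt_mul_zpowDiagGL_mul_eq_of_antitone`); `ncard_cosets_piPowGL_le` —
  `#(K ϖ^a K ∕ K) ≤ (|a|+1)^N q^{(N−1)|a|}` for `a ≥ 0` (★ `ncard_cosets_glIntDet_le_pow_mul`, `K ϖ^a K ⊆ Δ_{|a|}`); `ncard_cosets_inv_le` —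
  `#(K ϖ^{−a} K ∕ K) ≤ #(K ϖ^{a} K ∕ K)` by the transpose-inverse automorphism `g ↦ (g⁻¹)ᵀ` (fixes `K`, sends `ϖ^a ↦ ϖ^{−a}`); and the two-sided
  **`ncard_cosets_zpowDiagGL_le`** — `#(K ϖ^a K ∕ K) ≤ ∏_i (|a_i|+1)^{2N} q^{(N−1)|a_i|}` for EVERY `a ∈ ℤ^N` (sign split `a = a⁺ − a⁻` + §1).
* §3 (transport + analysis) is the NEXT file `K2LiuSplitSliceCartanSeries`: `∑_{a antitone} ν(K₀ e⁻¹ϖ^a K₀)·ψ(e⁻¹ ϖ^a) < ∞` from a torus decay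
  `ψ(e⁻¹ ϖ^a) ≤ C ∏_i s^{|a_i|}` with `s·q^{N−1} < 1`, and with (A2) the integrability of the split slice modulo the torus decay (organ (D)).
The exponent `N − 1` is sharp (largest Hecke parameter of the trivial representation, attained on `a = (m, 0, …, 0)`), which is why #32d's
hypothesis `2 * (N:ℝ) - 2 < τ` cannot be weakened.  No good-place hypothesis is used: `K₀` is `e⁻¹ GL_N(𝒪)`, not `U(V)(𝒪_v)`.

HONEST LABEL.  Count-neutral helper (organ (V) of the split finite slice of #32d; the torus decay (D), the non-split places and the archimedean slice
remain): `HC_CM` is proved only modulo the 7 printed citations (2 remaining named inputs: hLiu418 = `stmt-HodgeConjecture-24832`, h413 =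
`stmt-HodgeConjecture-24833`) until rung 0 closes.

References: [Macdonald1995] I. G. Macdonald, *Symmetric functions and Hall polynomials* (2nd ed.), Ch. V §2 (2.6), (2.9), §3; [CartierCorvallis1979]
P. Cartier, PSPM 33.1, §IV.2; [Bump1997] D. Bump, *Automorphic forms and representations*, Prop. 4.6.2; [GelbartPiatetskishapiroRallis1987] LNM 1254,
Part A §6; [Li1992] J.-S. Li, J. reine angew. Math. 428, §3; [Liu2011] Y. Liu, Algebra Number Theory 5 (2011), §2C.
-/

set_option autoImplicit false
-- the mandated namespace repeats the single-problem summit's segment (`HodgeConjecture.HodgeConjecture`)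
set_option linter.dupNamespace false

noncomputable section

open scoped ENNReal Pointwise
open MeasureTheory

namespace Summit.HodgeConjecture.HodgeConjecture.Cruxes.HLiu418.K2LiuSplitCosetCount

open Literature.NumberTheory.K2Lit.SiegelDoubled
open Literature.NumberTheory.Automorphic

/-! ## §1 Counting left cosets inside subsets of a group -/

section Generic

variable {G : Type} [Group G] {G' : Type} [Group G']

/-- **transport of coset counts along a homomorphism**: if `φ : G →* G′` satisfies `φ x ∈ K′ ↔ x ∈ K`, then `xK ↦ φ(x)K′` is a well defined
injection `G ∕ K ↪ G′ ∕ K′` mapping the cosets met by `D` to cosets met by `φ(D)`; hence if `φ(D)` meets finitely many cosets so does `D`, and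
`#(D ∕ K) ≤ #(φ D ∕ K′)`. [cite: Macdonald1995, Ch. V §2 (2.6)] -/
theorem finite_and_ncard_image_mk_le_of_hom (K : Subgroup G) (K' : Subgroup G') (φ : G →* G') (hφ : ∀ x, φ x ∈ K' ↔ x ∈ K) (D : Set G)
    (hfin : (QuotientGroup.mk '' (φ '' D) : Set (G' ⧸ K')).Finite) :
    (QuotientGroup.mk '' D : Set (G ⧸ K)).Finite ∧
      (QuotientGroup.mk '' D : Set (G ⧸ K)).ncard ≤ (QuotientGroup.mk '' (φ '' D) : Set (G' ⧸ K')).ncard := by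
  let f : G ⧸ K → G' ⧸ K' := fun γ => QuotientGroup.mk (φ γ.out)
  have hinj : Set.InjOn f (QuotientGroup.mk '' D) := by
    intro γ₁ _ γ₂ _ h
    have h' : (φ γ₁.out)⁻¹ * φ γ₂.out ∈ K' := QuotientGroup.eq.1 h
    rw [← map_inv, ← map_mul, hφ] at h'
    rw [← QuotientGroup.out_eq' γ₁, ← QuotientGroup.out_eq' γ₂]
    exact QuotientGroup.eq.2 h'
  have hmaps : ∀ γ ∈ (QuotientGroup.mk '' D : Set (G ⧸ K)), f γ ∈ (QuotientGroup.mk '' (φ '' D) : Set (G' ⧸ K')) := by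
    rintro γ ⟨d, hd, rfl⟩
    obtain ⟨k, hk⟩ := QuotientGroup.mk_out_eq_mul K d
    refine ⟨φ d, ⟨d, hd, rfl⟩, ?_⟩
    show (QuotientGroup.mk (φ d) : G' ⧸ K') = QuotientGroup.mk (φ (QuotientGroup.mk d : G ⧸ K).out)
    rw [hk, map_mul]
    exact QuotientGroup.eq.2 (by rw [← mul_assoc, inv_mul_cancel, one_mul]; exact (hφ _).2 k.2)
  have himg : f '' (QuotientGroup.mk '' D) ⊆ QuotientGroup.mk '' (φ '' D) := by
    rintro _ ⟨γ, hγ, rfl⟩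
    exact hmaps γ hγ
  exact ⟨(hfin.subset himg).of_finite_image hinj, Set.ncard_le_ncard_of_injOn f hmaps hinj hfin⟩

/-- **submultiplicativity of coset counts**: for `B` stable under left multiplication by `K`, the product set `A · B` meets at most
`#(A ∕ K) · #(B ∕ K)` left cosets of `K` — `A·B = ⋃_i a_i K · B = ⋃_i a_i · B = ⋃_{i,j} a_i b_j K`. [cite: Macdonald1995, Ch. V §2 (2.6)] -/
theorem ncard_image_mk_mul_le (K : Subgroup G) (A B : Set G) (hB : ∀ k ∈ K, ∀ b ∈ B, k * b ∈ B)
    (hA : (QuotientGroup.mk '' A : Set (G ⧸ K)).Finite) (hBf : (QuotientGroup.mk '' B : Set (G ⧸ K)).Finite) :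
    (QuotientGroup.mk '' (A * B) : Set (G ⧸ K)).ncard ≤
      (QuotientGroup.mk '' A : Set (G ⧸ K)).ncard * (QuotientGroup.mk '' B : Set (G ⧸ K)).ncard := by
  classical
  have hsub : (QuotientGroup.mk '' (A * B) : Set (G ⧸ K)) ⊆
      ↑(hA.toFinset.biUnion fun γ => hBf.toFinset.image fun δ : G ⧸ K => γ.out • δ) := by
    rintro _ ⟨_, ⟨a, ha, b, hb, rfl⟩, rfl⟩
    obtain ⟨k, hk⟩ := QuotientGroup.mk_out_eq_mul K a
    rw [Finset.coe_biUnion, Set.mem_iUnion₂]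
    refine ⟨QuotientGroup.mk a, by rw [Finset.mem_coe, Set.Finite.mem_toFinset]; exact ⟨a, ha, rfl⟩, ?_⟩
    rw [Finset.coe_image, Set.Finite.coe_toFinset]
    refine ⟨QuotientGroup.mk ((k : G)⁻¹ * b), ⟨(k : G)⁻¹ * b, hB _ (inv_mem k.2) b hb, rfl⟩, ?_⟩
    show (QuotientGroup.mk a : G ⧸ K).out • (QuotientGroup.mk ((k : G)⁻¹ * b) : G ⧸ K) = QuotientGroup.mk (a * b)
    rw [MulAction.Quotient.smul_mk, hk, smul_eq_mul]
    congr 1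
    group
  calc (QuotientGroup.mk '' (A * B) : Set (G ⧸ K)).ncard
      ≤ (↑(hA.toFinset.biUnion fun γ => hBf.toFinset.image fun δ : G ⧸ K => γ.out • δ) : Set (G ⧸ K)).ncard :=
        Set.ncard_le_ncard hsub (Finset.finite_toSet _)
    _ = (hA.toFinset.biUnion fun γ => hBf.toFinset.image fun δ : G ⧸ K => γ.out • δ).card := Set.ncard_coe_finset _
    _ ≤ ∑ γ ∈ hA.toFinset, (hBf.toFinset.image fun δ : G ⧸ K => γ.out • δ).card := Finset.card_biUnion_le
    _ ≤ ∑ γ ∈ hA.toFinset, hBf.toFinset.card := Finset.sum_le_sum fun γ _ => Finset.card_image_le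
    _ = (QuotientGroup.mk '' A : Set (G ⧸ K)).ncard * (QuotientGroup.mk '' B : Set (G ⧸ K)).ncard := by
        rw [Finset.sum_const, smul_eq_mul, Set.ncard_eq_toFinset_card _ hA, Set.ncard_eq_toFinset_card _ hBf]

/-- **volume from the coset count**: for a left-invariant measure `ν`, a set `D` meeting finitely many left cosets of `K` has
`ν(D) ≤ #(D ∕ K) · ν(K)` (`D ⊆ ⋃_{xK ∩ D ≠ ∅} xK`). [cite: Macdonald1995, Ch. V §2 (2.9)] -/
theorem measure_le_ncard_mul [MeasurableSpace G] [MeasurableMul G] (ν : Measure G) [ν.IsMulLeftInvariant] (K : Subgroup G) (D : Set G)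
    (hD : (QuotientGroup.mk '' D : Set (G ⧸ K)).Finite) :
    ν D ≤ ((QuotientGroup.mk '' D : Set (G ⧸ K)).ncard : ℝ≥0∞) * ν K := by
  have hsub : D ⊆ ⋃ γ ∈ hD.toFinset, (fun x => (γ.out)⁻¹ * x) ⁻¹' (K : Set G) := by
    intro d hd
    obtain ⟨k, hk⟩ := QuotientGroup.mk_out_eq_mul K d
    rw [Set.mem_iUnion₂]
    refine ⟨QuotientGroup.mk d, by rw [Set.Finite.mem_toFinset]; exact ⟨d, hd, rfl⟩, ?_⟩
    rw [Set.mem_preimage, hk, mul_inv_rev, mul_assoc, inv_mul_cancel, mul_one, SetLike.mem_coe]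
    exact inv_mem k.2
  calc ν D ≤ ν (⋃ γ ∈ hD.toFinset, (fun x => (γ.out)⁻¹ * x) ⁻¹' (K : Set G)) := measure_mono hsub
    _ ≤ ∑ γ ∈ hD.toFinset, ν ((fun x => (γ.out)⁻¹ * x) ⁻¹' (K : Set G)) := measure_biUnion_finset_le _ _
    _ = ∑ γ ∈ hD.toFinset, ν K := Finset.sum_congr rfl fun γ _ => measure_preimage_mul ν _ _
    _ = ((QuotientGroup.mk '' D : Set (G ⧸ K)).ncard : ℝ≥0∞) * ν K := by
        rw [Finset.sum_const, nsmul_eq_mul, Set.ncard_eq_toFinset_card _ hD]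

/-- the cosets met by a double coset `K g K` are those met by `{g}·K`-translates: `x K g K`-bookkeeping — membership in a transported double coset:
`g ∈ K₀ e⁻¹(t) K₀ ↔ e g ∈ K t K` when `e x ∈ K ↔ x ∈ K₀`. [cite: CartierCorvallis1979, §IV.2] -/
theorem mem_doubleCoset_symm_iff (e : G ≃* G') {K₀ : Subgroup G} {K : Subgroup G'} (hK : ∀ x, e x ∈ K ↔ x ∈ K₀) (t : G') (g : G) :
    g ∈ DoubleCoset.doubleCoset (e.symm t) (K₀ : Set G) K₀ ↔ e g ∈ DoubleCoset.doubleCoset t (K : Set G') K := by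
  rw [DoubleCoset.mem_doubleCoset, DoubleCoset.mem_doubleCoset]
  constructor
  · rintro ⟨x, hx, y, hy, rfl⟩
    exact ⟨e x, (hK x).2 hx, e y, (hK y).2 hy, by rw [map_mul, map_mul, MulEquiv.apply_symm_apply]⟩
  · rintro ⟨x, hx, y, hy, h⟩
    refine ⟨e.symm x, (hK _).1 (by rw [MulEquiv.apply_symm_apply]; exact hx),
      e.symm y, (hK _).1 (by rw [MulEquiv.apply_symm_apply]; exact hy), ?_⟩
    rw [← map_mul, ← map_mul, ← h, MulEquiv.symm_apply_apply]

/-- the image of a transported double coset: `e(K₀ e⁻¹(t) K₀) = K t K`. [cite: CartierCorvallis1979, §IV.2] -/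
theorem image_doubleCoset_symm (e : G ≃* G') {K₀ : Subgroup G} {K : Subgroup G'} (hK : ∀ x, e x ∈ K ↔ x ∈ K₀) (t : G') :
    (e : G → G') '' DoubleCoset.doubleCoset (e.symm t) (K₀ : Set G) K₀ = DoubleCoset.doubleCoset t (K : Set G') K := by
  ext y
  constructor
  · rintro ⟨g, hg, rfl⟩
    exact (mem_doubleCoset_symm_iff e hK t g).1 hg
  · intro hy
    exact ⟨e.symm y, (mem_doubleCoset_symm_iff e hK t _).2 (by rw [MulEquiv.apply_symm_apply]; exact hy), MulEquiv.apply_symm_apply e y⟩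

/-- **transport of a Cartan family** along a group isomorphism `e : G ≃* G′` with `e⁻¹ K = K₀`: if `G′ = ⨆_i K t_i K` then
`G = ⨆_i K₀ e⁻¹(t_i) K₀`. [cite: CartierCorvallis1979, §IV.2] -/
theorem isCartanFamily_of_mulEquiv {ι : Type} (e : G ≃* G') {K₀ : Subgroup G} {K : Subgroup G'} (hK : ∀ x, e x ∈ K ↔ x ∈ K₀)
    {t : ι → G'} (ht : IsCartanFamily K t) : IsCartanFamily K₀ fun i => e.symm (t i) := by
  refine ⟨fun g => ?_, fun i j hij => ?_⟩
  · obtain ⟨i, hi⟩ := ht.1 (e g)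
    exact ⟨i, (mem_doubleCoset_symm_iff e hK _ g).2 hi⟩
  · obtain ⟨g, hgi, hgj⟩ := hij
    exact ht.2 i j ⟨e g, (mem_doubleCoset_symm_iff e hK _ g).1 hgi, (mem_doubleCoset_symm_iff e hK _ g).1 hgj⟩

end Generic

/-! ## §2 `GL_N(F)`: the Cartan family `K ϖ^a K` and the growth of `#(K ϖ^a K ∕ K)` -/

section GeneralLinear

open ValuativeRel
open scoped Matrix

variable {F : Type} [Field F] [ValuativeRel F] {n : ℕ} {ϖ : F}

/-- **the Cartan decomposition of `GL_N(F)` as a ★ `IsCartanFamily`**: `GL_N(F) = ⨆_{a_1 ≥ ⋯ ≥ a_N} K ϖ^a K`, `K = GL_N(𝒪)`.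
[cite: CartierCorvallis1979, §IV.2] [cite: Macdonald1995, Ch. V §2 (2.2)] [cite: Bump1997, Prop. 4.6.2] -/
theorem isCartanFamily_glInt_zpowDiagGL [IsDiscreteValuationRing 𝒪[F]] (hϖ : IsUniformizingElement ϖ) :
    IsCartanFamily (glInt n F) (fun a : {a : Fin n → ℤ // Antitone a} => zpowDiagGL hϖ.ne_zero a.1) := by
  refine ⟨fun g => ?_, fun a b hab => ?_⟩
  · obtain ⟨k₁, hk₁, k₂, hk₂, a, ha, h⟩ := exists_glInt_mul_mul_eq_zpowDiagGL hϖ g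
    refine ⟨⟨a, ha⟩, DoubleCoset.mem_doubleCoset.2 ⟨k₁⁻¹, inv_mem hk₁, k₂⁻¹, inv_mem hk₂, ?_⟩⟩
    show g = k₁⁻¹ * zpowDiagGL hϖ.ne_zero a * k₂⁻¹
    rw [← h]
    group
  · obtain ⟨g, hga, hgb⟩ := hab
    obtain ⟨x, hx, y, hy, hgxy⟩ := DoubleCoset.mem_doubleCoset.1 hga
    obtain ⟨x', hx', y', hy', hgxy'⟩ := DoubleCoset.mem_doubleCoset.1 hgb
    apply Subtype.ext
    refine CartanUnique.eq_of_glInt_mul_zpowDiagGL_mul_eq_of_antitone hϖ a.2 b.2 (k₁ := x'⁻¹ * x) (k₂ := y * y'⁻¹)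
      (mul_mem (inv_mem hx') hx) (mul_mem hy (inv_mem hy')) ?_
    calc x'⁻¹ * x * zpowDiagGL hϖ.ne_zero a.1 * (y * y'⁻¹) = x'⁻¹ * (x * zpowDiagGL hϖ.ne_zero a.1 * y) * y'⁻¹ := by group
      _ = zpowDiagGL hϖ.ne_zero b.1 := by rw [← hgxy, hgxy']; group

/-- `K ϖ^a K ⊆ Δ_{|a|}` for `a ≥ 0`: the double coset of `diag(ϖ^{a_i})`, `a_i ∈ ℕ`, consists of integral matrices with `|det| = |ϖ|^{Σ a_i}`.
[cite: Macdonald1995, Ch. V §2 (2.6)] -/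
theorem doubleCoset_piPowGL_subset_glIntDet (hϖ : IsUniformizingElement ϖ) (a : Fin n → ℕ) :
    DoubleCoset.doubleCoset (piPowGL hϖ.ne_zero a) (glInt n F : Set (GL (Fin n) F)) (glInt n F) ⊆ glIntDet n ϖ (∑ i, a i) := by
  intro g hg
  obtain ⟨x, hx, y, hy, rfl⟩ := DoubleCoset.mem_doubleCoset.1 hg
  exact (mul_glInt_mem_glIntDet_iff hy).2 ((glInt_mul_mem_glIntDet_iff hx).2 (piPowGL_mem_glIntDet hϖ a))

/-- **`#(K ϖ^a K ∕ K) ≤ (|a|+1)^N · q^{(N−1)|a|}` for `a ≥ 0`** (`|a| = Σ a_i`, `q = #𝓀`): the cosets met by `K ϖ^a K` are among those of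
`Δ_{|a|} K ∕ K`, counted by ★ `ncard_cosets_glIntDet_le_pow_mul`. [cite: Macdonald1995, Ch. V (2.9), (4.6)] -/
theorem finite_and_ncard_cosets_piPowGL_le [Finite 𝓀[F]] (hϖ : IsUniformizingElement ϖ) (a : Fin n → ℕ) :
    (QuotientGroup.mk '' DoubleCoset.doubleCoset (piPowGL hϖ.ne_zero a) (glInt n F : Set (GL (Fin n) F)) (glInt n F) :
        Set (GL (Fin n) F ⧸ glInt n F)).Finite ∧
      (QuotientGroup.mk '' DoubleCoset.doubleCoset (piPowGL hϖ.ne_zero a) (glInt n F : Set (GL (Fin n) F)) (glInt n F) :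
          Set (GL (Fin n) F ⧸ glInt n F)).ncard ≤ (∑ i, a i + 1) ^ n * Nat.card 𝓀[F] ^ ((n - 1) * ∑ i, a i) := by
  have hsub : (QuotientGroup.mk '' DoubleCoset.doubleCoset (piPowGL hϖ.ne_zero a) (glInt n F : Set (GL (Fin n) F)) (glInt n F) :
      Set (GL (Fin n) F ⧸ glInt n F)) ⊆ {γ | γ.out ∈ glIntDet n ϖ (∑ i, a i)} := by
    rintro _ ⟨g, hg, rfl⟩
    exact (mk_out_mem_glIntDet_iff g).2 (doubleCoset_piPowGL_subset_glIntDet hϖ a hg)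
  exact ⟨(finite_cosets_glIntDet hϖ _).subset hsub,
    (Set.ncard_le_ncard hsub (finite_cosets_glIntDet hϖ _)).trans (ncard_cosets_glIntDet_le_pow_mul hϖ _)⟩

omit [ValuativeRel F] in
/-- the matrix of `(ϖ^a)⁻¹` is its own transpose (it is diagonal). [folklore] -/
theorem transpose_coe_zpowDiagGL_inv (hϖ0 : ϖ ≠ 0) (a : Fin n → ℤ) :
    (((zpowDiagGL hϖ0 a)⁻¹ : GL (Fin n) F) : Matrix (Fin n) (Fin n) F)ᵀ = (((zpowDiagGL hϖ0 a)⁻¹ : GL (Fin n) F) : Matrix (Fin n) (Fin n) F) := by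
  rw [← zpowDiagGL_neg, coe_zpowDiagGL, Matrix.diagonal_transpose]

/-- **`#(K ϖ^{−a} K ∕ K) ≤ #(K ϖ^{a} K ∕ K)`**: the transpose-inverse automorphism `g ↦ (g⁻¹)ᵀ` of `GL_N(F)` preserves `K = GL_N(𝒪)` and sends
`ϖ^{−a} ↦ ϖ^{a}`, so it injects the cosets met by `K ϖ^{−a} K` into those met by `K ϖ^{a} K` (§1). (Equality holds; only `≤` is used.)
[cite: Macdonald1995, Ch. V §2 (2.6)] -/
theorem finite_and_ncard_cosets_inv_le (hϖ0 : ϖ ≠ 0) (a : Fin n → ℤ)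
    (hfin : (QuotientGroup.mk '' DoubleCoset.doubleCoset (zpowDiagGL hϖ0 a) (glInt n F : Set (GL (Fin n) F)) (glInt n F) :
      Set (GL (Fin n) F ⧸ glInt n F)).Finite) :
    (QuotientGroup.mk '' DoubleCoset.doubleCoset (zpowDiagGL hϖ0 a)⁻¹ (glInt n F : Set (GL (Fin n) F)) (glInt n F) :
        Set (GL (Fin n) F ⧸ glInt n F)).Finite ∧
      (QuotientGroup.mk '' DoubleCoset.doubleCoset (zpowDiagGL hϖ0 a)⁻¹ (glInt n F : Set (GL (Fin n) F)) (glInt n F) :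
          Set (GL (Fin n) F ⧸ glInt n F)).ncard ≤
        (QuotientGroup.mk '' DoubleCoset.doubleCoset (zpowDiagGL hϖ0 a) (glInt n F : Set (GL (Fin n) F)) (glInt n F) :
          Set (GL (Fin n) F ⧸ glInt n F)).ncard := by
  -- the transpose-inverse automorphism `g ↦ (g⁻¹)ᵀ`
  let φ : GL (Fin n) F →* GL (Fin n) F :=
    { toFun := fun g => ⟨((g⁻¹ : GL (Fin n) F) : Matrix (Fin n) (Fin n) F)ᵀ, ((g : GL (Fin n) F) : Matrix (Fin n) (Fin n) F)ᵀ,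
        by rw [← Matrix.transpose_mul, ← Units.val_mul, mul_inv_cancel, Units.val_one, Matrix.transpose_one],
        by rw [← Matrix.transpose_mul, ← Units.val_mul, inv_mul_cancel, Units.val_one, Matrix.transpose_one]⟩
      map_one' := Units.ext (by simp)
      map_mul' := fun g h => Units.ext (by simp [Matrix.transpose_mul]) }
  have hφK : ∀ x, φ x ∈ glInt n F ↔ x ∈ glInt n F := fun x => by
    rw [mem_glInt_iff, mem_glInt_iff]
    exact ⟨fun h => ⟨fun i j => h.2 j i, fun i j => h.1 j i⟩, fun h => ⟨fun i j => h.2 j i, fun i j => h.1 j i⟩⟩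
  have hφt : φ (zpowDiagGL hϖ0 a) = (zpowDiagGL hϖ0 a)⁻¹ := Units.ext (transpose_coe_zpowDiagGL_inv hϖ0 a)
  have himg : (φ : GL (Fin n) F → GL (Fin n) F) '' DoubleCoset.doubleCoset (zpowDiagGL hϖ0 a)⁻¹ (glInt n F : Set (GL (Fin n) F)) (glInt n F) ⊆
      DoubleCoset.doubleCoset (zpowDiagGL hϖ0 a) (glInt n F : Set (GL (Fin n) F)) (glInt n F) := by
    rintro _ ⟨g, hg, rfl⟩
    obtain ⟨x, hx, y, hy, rfl⟩ := DoubleCoset.mem_doubleCoset.1 hg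
    rw [map_mul, map_mul, map_inv, hφt, inv_inv]
    exact DoubleCoset.mem_doubleCoset.2 ⟨φ x, (hφK x).2 hx, φ y, (hφK y).2 hy, rfl⟩
  have h := finite_and_ncard_image_mk_le_of_hom (glInt n F) (glInt n F) φ hφK _ (hfin.subset (Set.image_mono himg))
  exact ⟨h.1, h.2.trans (Set.ncard_le_ncard (Set.image_mono himg) hfin)⟩

/-- `Σ_i f_i + 1 ≤ ∏_i (f_i + 1)` for natural numbers. [folklore] -/
theorem sum_add_one_le_prod_add_one {ι : Type} (s : Finset ι) (f : ι → ℕ) : ∑ i ∈ s, f i + 1 ≤ ∏ i ∈ s, (f i + 1) := by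
  classical
  induction s using Finset.induction_on with
  | empty => simp
  | insert a s ha ih =>
    rw [Finset.sum_insert ha, Finset.prod_insert ha, add_assoc]
    have h1 : 1 ≤ ∏ i ∈ s, (f i + 1) := Nat.one_le_iff_ne_zero.2 (Finset.prod_ne_zero_iff.2 fun i _ => Nat.succ_ne_zero _)
    nlinarith

omit [ValuativeRel F] in
/-- the sign split `ϖ^a = ϖ^{a⁺} · (ϖ^{a⁻})⁻¹`, `a⁺_i = max(a_i, 0)`, `a⁻_i = max(−a_i, 0)`. [folklore] -/
theorem zpowDiagGL_eq_piPowGL_mul_inv (hϖ0 : ϖ ≠ 0) (a : Fin n → ℤ) :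
    zpowDiagGL hϖ0 a = piPowGL hϖ0 (fun i => (a i).toNat) * (piPowGL hϖ0 (fun i => (-a i).toNat))⁻¹ := by
  rw [← zpowDiagGL_natCast, ← zpowDiagGL_natCast, ← zpowDiagGL_neg, ← zpowDiagGL_add]
  congr 1
  funext i
  simp only [Pi.add_apply, Pi.neg_apply]
  rw [← sub_eq_add_neg, Int.toNat_sub_toNat_neg]

/-- **`#(K ϖ^a K ∕ K) ≤ ∏_i (|a_i|+1)^{2N} · q^{(N−1)|a_i|}` for every `a ∈ ℤ^N`** — the two-sided coset growth: `K ϖ^a K ⊆ (K ϖ^{a⁺} K)·(K ϖ^{−a⁻} K)`,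
submultiplicativity (§1), the one-sided bound for `a⁺` and — through the transpose-inverse symmetry — for `a⁻`, and
`(|a⁺|+1)(|a⁻|+1) ≤ ∏_i (|a_i|+1)^2`.  The rate `q^{N−1}` per unit of `Σ|a_i|` is sharp (attained at `a = (m, 0, …, 0)`).
[cite: Macdonald1995, Ch. V (2.9), (4.6)] [cite: CartierCorvallis1979, §IV.2] -/
theorem finite_and_ncard_cosets_zpowDiagGL_le [Finite 𝓀[F]] (hϖ : IsUniformizingElement ϖ) (a : Fin n → ℤ) :
    (QuotientGroup.mk '' DoubleCoset.doubleCoset (zpowDiagGL hϖ.ne_zero a) (glInt n F : Set (GL (Fin n) F)) (glInt n F) :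
        Set (GL (Fin n) F ⧸ glInt n F)).Finite ∧
      (QuotientGroup.mk '' DoubleCoset.doubleCoset (zpowDiagGL hϖ.ne_zero a) (glInt n F : Set (GL (Fin n) F)) (glInt n F) :
          Set (GL (Fin n) F ⧸ glInt n F)).ncard ≤ ∏ i, ((a i).natAbs + 1) ^ (2 * n) * Nat.card 𝓀[F] ^ ((n - 1) * (a i).natAbs) := by
  set K : Subgroup (GL (Fin n) F) := glInt n F
  set ap : Fin n → ℕ := fun i => (a i).toNat
  set am : Fin n → ℕ := fun i => (-a i).toNat
  -- the two one-sided pieces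
  have hp := finite_and_ncard_cosets_piPowGL_le (n := n) hϖ ap
  have hm0 := finite_and_ncard_cosets_piPowGL_le (n := n) hϖ am
  have hmz : zpowDiagGL hϖ.ne_zero (fun i => (am i : ℤ)) = piPowGL hϖ.ne_zero am := zpowDiagGL_natCast _ _
  have hm := finite_and_ncard_cosets_inv_le hϖ.ne_zero (fun i => (am i : ℤ)) (by rw [hmz]; exact hm0.1)
  rw [hmz] at hm
  -- `K ϖ^a K ⊆ (K ϖ^{a⁺} K) · (K (ϖ^{a⁻})⁻¹ K)`
  have hsub : DoubleCoset.doubleCoset (zpowDiagGL hϖ.ne_zero a) (K : Set (GL (Fin n) F)) K ⊆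
      DoubleCoset.doubleCoset (piPowGL hϖ.ne_zero ap) (K : Set (GL (Fin n) F)) K *
        DoubleCoset.doubleCoset (piPowGL hϖ.ne_zero am)⁻¹ (K : Set (GL (Fin n) F)) K := by
    intro g hg
    obtain ⟨x, hx, y, hy, rfl⟩ := DoubleCoset.mem_doubleCoset.1 hg
    refine Set.mem_mul.2 ⟨x * piPowGL hϖ.ne_zero ap * 1, DoubleCoset.mem_doubleCoset.2 ⟨x, hx, 1, one_mem K, rfl⟩,
      1 * (piPowGL hϖ.ne_zero am)⁻¹ * y, DoubleCoset.mem_doubleCoset.2 ⟨1, one_mem K, y, hy, rfl⟩, ?_⟩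
    have hap : zpowDiagGL hϖ.ne_zero a = piPowGL hϖ.ne_zero ap * (piPowGL hϖ.ne_zero am)⁻¹ := zpowDiagGL_eq_piPowGL_mul_inv hϖ.ne_zero a
    rw [hap]
    group
  have hB : ∀ k ∈ K, ∀ b ∈ DoubleCoset.doubleCoset (piPowGL hϖ.ne_zero am)⁻¹ (K : Set (GL (Fin n) F)) K,
      k * b ∈ DoubleCoset.doubleCoset (piPowGL hϖ.ne_zero am)⁻¹ (K : Set (GL (Fin n) F)) K := by
    intro k hk b hb
    obtain ⟨x, hx, y, hy, rfl⟩ := DoubleCoset.mem_doubleCoset.1 hb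
    exact DoubleCoset.mem_doubleCoset.2 ⟨k * x, mul_mem hk hx, y, hy, by group⟩
  have hprod := ncard_image_mk_mul_le K _ _ hB hp.1 hm.1
  have hfinAB : (QuotientGroup.mk '' (DoubleCoset.doubleCoset (piPowGL hϖ.ne_zero ap) (K : Set (GL (Fin n) F)) K *
      DoubleCoset.doubleCoset (piPowGL hϖ.ne_zero am)⁻¹ (K : Set (GL (Fin n) F)) K) : Set (GL (Fin n) F ⧸ K)).Finite := by
    classical
    refine (Finset.finite_toSet (hp.1.toFinset.biUnion fun γ => hm.1.toFinset.image fun δ : GL (Fin n) F ⧸ K => γ.out • δ)).subset ?_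
    rintro _ ⟨_, ⟨u, hu, b, hb, rfl⟩, rfl⟩
    obtain ⟨k, hk⟩ := QuotientGroup.mk_out_eq_mul K u
    rw [Finset.coe_biUnion, Set.mem_iUnion₂]
    refine ⟨QuotientGroup.mk u, by rw [Finset.mem_coe, Set.Finite.mem_toFinset]; exact ⟨u, hu, rfl⟩, ?_⟩
    rw [Finset.coe_image, Set.Finite.coe_toFinset]
    refine ⟨QuotientGroup.mk ((k : GL (Fin n) F)⁻¹ * b), ⟨(k : GL (Fin n) F)⁻¹ * b, hB _ (inv_mem k.2) b hb, rfl⟩, ?_⟩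
    show (QuotientGroup.mk u : GL (Fin n) F ⧸ K).out • (QuotientGroup.mk ((k : GL (Fin n) F)⁻¹ * b) : GL (Fin n) F ⧸ K) =
      QuotientGroup.mk (u * b)
    rw [MulAction.Quotient.smul_mk, hk, smul_eq_mul]
    congr 1
    group
  refine ⟨hfinAB.subset (Set.image_mono hsub), ?_⟩
  -- arithmetic
  have hle : (∑ i, ap i + 1) ^ n * Nat.card 𝓀[F] ^ ((n - 1) * ∑ i, ap i) * ((∑ i, am i + 1) ^ n * Nat.card 𝓀[F] ^ ((n - 1) * ∑ i, am i)) ≤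
      ∏ i, ((a i).natAbs + 1) ^ (2 * n) * Nat.card 𝓀[F] ^ ((n - 1) * (a i).natAbs) := by
    have hpm : ∀ i, ap i + am i = (a i).natAbs := fun i => Int.toNat_add_toNat_neg_eq_natAbs (a i)
    have h1 : ∑ i, ap i + 1 ≤ ∏ i, ((a i).natAbs + 1) :=
      (sum_add_one_le_prod_add_one _ _).trans (Finset.prod_le_prod' fun i _ => by rw [← hpm i]; omega)
    have h2 : ∑ i, am i + 1 ≤ ∏ i, ((a i).natAbs + 1) :=
      (sum_add_one_le_prod_add_one _ _).trans (Finset.prod_le_prod' fun i _ => by rw [← hpm i]; omega)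
    have hsum : (n - 1) * ∑ i, ap i + (n - 1) * ∑ i, am i = ∑ i, (n - 1) * (a i).natAbs := by
      rw [← Nat.mul_add, ← Finset.sum_add_distrib, Finset.mul_sum]
      exact Finset.sum_congr rfl fun i _ => by rw [hpm i]
    calc (∑ i, ap i + 1) ^ n * Nat.card 𝓀[F] ^ ((n - 1) * ∑ i, ap i) * ((∑ i, am i + 1) ^ n * Nat.card 𝓀[F] ^ ((n - 1) * ∑ i, am i))
        = (∑ i, ap i + 1) ^ n * (∑ i, am i + 1) ^ n * (Nat.card 𝓀[F] ^ ((n - 1) * ∑ i, ap i) * Nat.card 𝓀[F] ^ ((n - 1) * ∑ i, am i)) := by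
          ring
      _ ≤ (∏ i, ((a i).natAbs + 1)) ^ n * (∏ i, ((a i).natAbs + 1)) ^ n *
            (Nat.card 𝓀[F] ^ ((n - 1) * ∑ i, ap i) * Nat.card 𝓀[F] ^ ((n - 1) * ∑ i, am i)) := by
          gcongr
      _ = ∏ i, ((a i).natAbs + 1) ^ (2 * n) * Nat.card 𝓀[F] ^ ((n - 1) * (a i).natAbs) := by
          rw [Finset.prod_mul_distrib, Finset.prod_pow, Finset.prod_pow_eq_pow_sum, ← pow_add, ← pow_add, ← two_mul, hsum]
  calc (QuotientGroup.mk '' DoubleCoset.doubleCoset (zpowDiagGL hϖ.ne_zero a) (K : Set (GL (Fin n) F)) K : Set (GL (Fin n) F ⧸ K)).ncard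
      ≤ (QuotientGroup.mk '' (DoubleCoset.doubleCoset (piPowGL hϖ.ne_zero ap) (K : Set (GL (Fin n) F)) K *
          DoubleCoset.doubleCoset (piPowGL hϖ.ne_zero am)⁻¹ (K : Set (GL (Fin n) F)) K) : Set (GL (Fin n) F ⧸ K)).ncard :=
        Set.ncard_le_ncard (Set.image_mono hsub) hfinAB
    _ ≤ _ := hprod
    _ ≤ (∑ i, ap i + 1) ^ n * Nat.card 𝓀[F] ^ ((n - 1) * ∑ i, ap i) * ((∑ i, am i + 1) ^ n * Nat.card 𝓀[F] ^ ((n - 1) * ∑ i, am i)) :=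
        Nat.mul_le_mul hp.2 (hm.2.trans hm0.2)
    _ ≤ _ := hle

end GeneralLinear


end Summit.HodgeConjecture.HodgeConjecture.Cruxes.HLiu418.K2LiuSplitCosetCount

end
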